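import Summits.CriticalPhenomena.PercolationContinuityZ3.Theorems.Transplant.KNCells2SepQO
import Summits.CriticalPhenomena.PercolationContinuityZ3.Theorems.Transplant.KNCells2SepQ
import Summits.CriticalPhenomena.PercolationContinuityZ3.Theorems.Transplant.KNCells2CorridorSub
import Summits.CriticalPhenomena.PercolationContinuityZ3.Theorems.Transplant.KNCells2FaceSub
import Summits.CriticalPhenomena.PercolationContinuityZ3.Theorems.Transplant.KNCells2RootSub
import Summits.CriticalPhenomena.PercolationContinuityZ3.Theorems.Transplant.SkelTubeLevels
import Summits.CriticalPhenomena.PercolationContinuityZ3.Theorems.Transplant.KNCellsSchemeO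
import Summits.CriticalPhenomena.PercolationContinuityZ3.Theorems.Transplant.KNCellsProcessO
import Summits.CriticalPhenomena.PercolationContinuityZ3.Theorems.Transplant.KNCellsRunO
import Summits.CriticalPhenomena.PercolationContinuityZ3.Theorems.Transplant.KNCellsRunInvO
import Summits.CriticalPhenomena.PercolationContinuityZ3.Theorems.Transplant.KNCells2SchemeO
import Summits.CriticalPhenomena.PercolationContinuityZ3.Theorems.Transplant.KNCells2RunO
import Summits.CriticalPhenomena.PercolationContinuityZ3.Theorems.Transplant.KNCells2RunInvO
import Summits.CriticalPhenomena.PercolationContinuityZ3.Theorems.Transplant.KNCellsCoverO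
import Summits.CriticalPhenomena.PercolationContinuityZ3.Theorems.Transplant.KNCells2CoverO
import Summits.CriticalPhenomena.PercolationContinuityZ3.Theorems.Transplant.KNCellsStepsDefsO
import Summits.CriticalPhenomena.PercolationContinuityZ3.Theorems.Transplant.KNCellsStepsReachO
import Summits.CriticalPhenomena.PercolationContinuityZ3.Theorems.Transplant.KNCellsStepsPinO
import Summits.CriticalPhenomena.PercolationContinuityZ3.Theorems.Transplant.KNCellsStepsSubboxO
import Summits.CriticalPhenomena.PercolationContinuityZ3.Theorems.Transplant.KNCells2FacePrefixO
import Summits.CriticalPhenomena.PercolationContinuityZ3.Theorems.Transplant.KNCells2CorridorO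
import Summits.CriticalPhenomena.PercolationContinuityZ3.Theorems.Transplant.KNCells2CorridorEdgeO
import Summits.CriticalPhenomena.PercolationContinuityZ3.Theorems.Transplant.KNCells2RootChainO
import Summits.CriticalPhenomena.PercolationContinuityZ3.Theorems.Transplant.SkelTubeSub
import Literature.Probability.Percolation.OrientedHistorySiteRenormalizationRun
import HarnessLib

/-!
# N2 (frames-only node `SamePDropOfSkeletonFrm₁`, OPEN) — ORIENTED MACRO LAYER (WAVE 0 (c1), (R-18) `q ≡ true`): the oriented twin of N1's `SkelTubeSub`

builds on p205010 (kernel theorem, internal audit signed; external expert review pending) — nothing in this file uses p205010; NOTHING is claimed about the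
open node `SamePDropOfSkeletonFrm₁` (`SamePDropOfSkeletonNeg₁` is CLOSED in the tree and untouched by this file).
Status sentence (coordinator 2026-08-20T04:30Z): "θ(p_c) = 0 on ℤ^d, all d ≥ 2 — kernel-verified (Lean 4/Mathlib, standard axioms); internal adversarial
audit SIGNED 2026-08-20 04:29Z; external expert review pending."
Lane `prim-bschramm-*`, seat `prim-bschramm-stmt` (gen 19); helper file (`--supports stmt-CriticalPhenomena-4575 --as helper`); N2-SCOPE §20, (R-18)/(R-19).
PORT RULES (HOME/prim-bschramm-stmt-g19/lean/port_orient.py): the history-site API is replaced by its ORIENTED twin at the fixed quadrant `qNE := fun _ => true`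
(`HState.choice ↦ HState.ochoice qNE`, `mstOf ↦ omstOf qNE`, `mst/stN ↦ omst/ostN qNE`, `occFinal ↦ ooccFinal qNE`, `Lawful ↦ OLawful qNE`, onward directions
`onward ↦ onwardO` = the POSITIVE ones, (N2-e)); every declaration whose text changes thereby — directly or through a changed declaration — is re-declared with the
suffix `O` (same namespace); unchanged declarations of the N1 file are NOT repeated (the N1 module is imported). Docstrings/citations are N1's.
N1 HEADER (kept for the reader):
* **`isSubbox_Wcor_win`** (corridor law), **`isSubbox_Wt_win`** (face law), **`isSubbox_W0sub_win`** (root law cut to the ball).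
The remaining instance obligation `hout` ("a vertex of `E_{v,x} ∪ H` resp. `E_{v,x} ∪ E^far` adjacent to the fresh region lies in the ball") is
a DEPTH bound: it holds as soon as `R` dominates the radii of those regions (`Skel.cellGeomSG`: `rB`, `rQ'`, `ρ`, resp. `rE`); note that the
product's planar-edge trick for the `cond_j` habitat (`tube_adj_of_mem_Ewv_Efar`: an `E_{v,x}`-neighbour of the far region is joined by a PLANAR
edge, hence has the same fibre) has no generic twin — over a skeleton take the window radius `R ≥ max (rB, rQ', rE)` for the face law too.
[cite: KozmaNitzan2024, §4 p. 17 (subbox), p. 26 ((29)), p. 28, p. 30, p. 31] [cite: GrimmettPercolation1999, §7.2]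
-/
noncomputable section

open scoped Classical

namespace Summit.CriticalPhenomena.PercolationContinuityZ3.Theorems

namespace Transplant

namespace Skel

open Literature.Probability.Percolation Literature.Probability.LatticeModels SimpleGraph GadgetSystem ProbeHistory HSiteScheme Contour KNCells
open KNCells.KSchA
open Literature.Barriers.CriticalPhenomena (graphBall)

variable {V : Type} [DecidableEq V] (G : SimpleGraph V) [G.LocallyFinite]
variable {A : Type*} {S : KSchA V A} {FD : FaceData V A} {LD : LevelData V A}
variable {h : ProbeHistory V} {e : Site 2 × MDir} {a a' b : A} {du : MDir}

/-- **The corridor law `Wcor` is a subbox weighting of the window graph on a fresh region `Dd`** inside the ball `B_G(w₀, R)`, the habitat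
`Q_b(x) ∪ E^far_{a'}(x,du)`, `Sx` and `Ucor`, provided every vertex of `E_{v,x} ∪ H_{x,y}` adjacent to `Dd` lies in the ball (the explored
region cannot touch `Dd`: `QSepGeom` + validity). [cite: KozmaNitzan2024, §4 p. 17 (subbox), p. 31] -/
theorem isSubbox_Wcor_winO (w₀ : V) (R : ℕ) (hL : LevelGeom G S.Γ FD LD) (hQ : QSepGeom G S.Γ) (hV : S.Valid₂O G h e)
    (hdu : du ∈ S.onwardO G h (tgt e)) {Dd : Finset V} (hDh : Dd ⊆ S.Γ.Q b (tgt e) ∪ S.Γ.Efar a' (tgt e) du)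
    (hD : Dd ⊆ S.Sx G h e a a' du) (hDU : Dd ⊆ S.Ucor G FD h e a a' du) (hπ : ∀ u ∈ Dd, u ∈ graphBall G w₀ R)
    (hout : ∀ v ∈ Dd, ∀ x ∈ S.Γ.Ewv a e.1 e.2 ∪ FD.Hfull a' (tgt e) du, G.Adj x v → x ∈ graphBall G w₀ R) :
    KNLevels.IsSubbox (winGraph G w₀ R) (S.Wcor G FD h e a a' du) S.p Dd :=
  isSubbox_Wcor_graph (winGraph G w₀ R) (winGraph_le G w₀ R) hV.F_eq hD hDU (disjoint_Vx_of_freshO hL hQ hV hdu hDh)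
    (fun u hu v hv hadj => (winGraph_adj G).2 ⟨hadj, hπ u hu, hπ v hv⟩)
    (fun v hv x hx _ hadj => (winGraph_adj G).2 ⟨hadj, hout v hv x (mem_of_adj_freshO hL hQ hV hdu hDh hv hx hadj) hadj, hπ v hv⟩)

/-- **The face law `Wt` is a subbox weighting of the window graph on a fresh region `Dd`** inside the ball, the habitat
`Q_b(x) ∪ E^far_{a'}(x,du)` and `Sx`, disjoint from `E_{v,x} ∪ Stub_j`, provided every vertex of `E_{v,x} ∪ E^far` adjacent to `Dd` lies in
the ball. [cite: KozmaNitzan2024, §4 p. 17 (subbox), p. 30 (Step III)] -/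
theorem isSubbox_Wt_winO (w₀ : V) (R : ℕ) (hL : LevelGeom G S.Γ FD LD) (hQ : QSepGeom G S.Γ) (hV : S.Valid₂O G h e)
    (hdu : du ∈ S.onwardO G h (tgt e)) {j : ℕ} {o : Finset (Sym2 V)} {Dd : Finset V}
    (hDh : Dd ⊆ S.Γ.Q b (tgt e) ∪ S.Γ.Efar a' (tgt e) du) (hD : Dd ⊆ S.Sx G h e a a' du)
    (hdis : Disjoint Dd (S.Γ.Ewv a e.1 e.2 ∪ S.Γ.Stub a' (tgt e) du j)) (hπ : ∀ u ∈ Dd, u ∈ graphBall G w₀ R)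
    (hout : ∀ v ∈ Dd, ∀ x ∈ S.Γ.Ewv a e.1 e.2 ∪ S.Γ.Efar a' (tgt e) du, G.Adj x v → x ∈ graphBall G w₀ R) :
    KNLevels.IsSubbox (winGraph G w₀ R) (S.Wt G h e a a' du j o) S.p Dd :=
  isSubbox_Wt_graph (winGraph G w₀ R) (winGraph_le G w₀ R) hD
    (Finset.disjoint_union_right.2 ⟨Finset.disjoint_union_right.2
      ⟨disjoint_Vx_of_freshO hL hQ hV hdu hDh, (Finset.disjoint_union_right.1 hdis).1⟩, (Finset.disjoint_union_right.1 hdis).2⟩)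
    (fun u hu v hv hadj => (winGraph_adj G).2 ⟨hadj, hπ u hu, hπ v hv⟩)
    (fun v hv x hx _ hadj => (winGraph_adj G).2 ⟨hadj, hout v hv x (mem_Sx_of_adj_freshO hL hQ hV hdu hDh hv hx hadj) hadj, hπ v hv⟩)

end Skel

end Transplant

end Summit.CriticalPhenomena.PercolationContinuityZ3.Theorems

end
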